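import Mathlib
import Summits.NavierStokesRegularity.NavierStokesRegularity.Theorems.FilamentSkeletonRssKelvinGateFreeResolvent
import Literature.Analysis.FluidPDE.HeatGradDivCalculus

/-!
# Route `FilamentSkeletonRss` · crux `TransverseReductionRJ` (stmt-NavierStokesRegularity-21221) — line `kelvin_gate`,
# stub S2′ `EventualKelvinGate`: the free resolvent is LINEAR and PRESERVES INCOMPRESSIBILITY

Helper file (theorems only, `--supports stmt-NavierStokesRegularity-21221 --as helper`).  HONEST FRAMING:
analysis bookkeeping for a HYPOTHETICAL filament-type rotating-self-similar blow-up route; nothing here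
bears on Navier–Stokes regularity; no stub is proved here.

Complements `…KelvinGateFreeResolvent` (`free_resolvent`: `W = ∫₀^∞ W_s ds ∈ X` solves `𝓛_(α,0) W = F` for `F ∈ Y`):

* `divergence_conj`, `divergence_freeSlice` — `div W_s (y) = e^{-s} · e^{τ_sΔ}(div F)(x)`, hence `0` for solenoidal `F`
  (the divergence commutes with rotations, dilations and the caloric extension);
* `isDivFree_freeResolvent` — **`div F = 0 ⇒ div W = 0`** (`div` under the integral sign);
* `freeResolvent_add_smul` — the resolvent is linear in the forcing (gate clause (2) at the trivial base);
* `free_resolvent_divFree` — packaged: for solenoidal `F ∈ Y` the free resolvent is a solenoidal `X`-field solving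
  `𝓛_(α,0) W + ∇0 = F`, i.e. the free gate with zero pressure and no modes on the divergence-free part of the Y-scale.
What remains for the full free gate: non-solenoidal forcings (Leray projection / pressure, Hölder classes).
-/

set_option linter.dupNamespace false

noncomputable section

namespace Summit.NavierStokesRegularity.NavierStokesRegularity.Theorems.KelvinGate

open Set Function Filter Topology InnerProductSpace MeasureTheory Real Metric
open Literature.Analysis.FluidPDE Literature.Analysis.UnboundedOperators
open scoped Laplacian RealInnerProductSpace ContDiff Topology ENNReal BigOperators

/-! ## The divergence of a conjugated field and of the slices -/

/-- `div[(c R_{−θ}) g (c R_θ ·)](y) = c² (div g)(c R_θ y)` (trace of a conjugate; dilation rule). -/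
theorem divergence_conj (g : EuclideanSpace ℝ (Fin 3) → EuclideanSpace ℝ (Fin 3)) (c θ : ℝ) (y : EuclideanSpace ℝ (Fin 3)) :
    VectorCalculus.divergence (fun z => (c • rotZL (-θ)) (g ((c • rotZL θ) z))) y =
      c ^ 2 * VectorCalculus.divergence g ((c • rotZL θ) y) := by
  set h : EuclideanSpace ℝ (Fin 3) → EuclideanSpace ℝ (Fin 3) := fun z => c • g (c • z) with hh
  have hfun : (fun z => (c • rotZL (-θ)) (g ((c • rotZL θ) z))) =
      fun z => (rotZLIE (-θ)) (h ((rotZLIE (-θ)).symm z)) := by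
    funext z
    simp only [hh, smul_apply, rotZL_apply, rotZLIE_apply, rotZLIE_symm_apply, neg_neg, map_smul]
  rw [hfun, divergence_conj_linearIsometryEquiv (rotZLIE (-θ)) h y]
  simp only [rotZLIE_symm_apply, neg_neg, hh]
  rw [divergence_smul_comp_smul g c]
  simp only [smul_apply, rotZL_apply]

section Div

variable {F : EuclideanSpace ℝ (Fin 3) → EuclideanSpace ℝ (Fin 3)} {C₀ C₁ : ℝ}

/-- **`div W_s (y) = e^{-s} · e^{τ_sΔ}(div F)(e^{-s/2} R_{αs} y)`** for `F ∈ C¹` bounded with bounded derivative. -/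
theorem divergence_freeSlice (hF : ContDiff ℝ 1 F) (h0 : ∀ z, ‖F z‖ ≤ C₀) (h1 : ∀ z, ‖fderiv ℝ F z‖ ≤ C₁)
    (α : ℝ) {s : ℝ} (hs : 0 < s) (y : EuclideanSpace ℝ (Fin 3)) :
    VectorCalculus.divergence (fun z => (Real.exp (-(s / 2)) • rotZL (-(α * s)))
        (heatExtension F (1 - Real.exp (-s)) ((Real.exp (-(s / 2)) • rotZL (α * s)) z))) y =
      Real.exp (-s) * heatExtension (VectorCalculus.divergence F) (1 - Real.exp (-s))
        ((Real.exp (-(s / 2)) • rotZL (α * s)) y) := by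
  rw [divergence_conj, exp_neg_half_sq', divergence_heatExtension_of_bounded hF h0 h1 (heatTime_mem_Ioc hs).1]

/-- For SOLENOIDAL forcings every slice is solenoidal: `div F = 0 ⇒ div W_s = 0`. -/
theorem divergence_freeSlice_eq_zero (hF : ContDiff ℝ 1 F) (h0 : ∀ z, ‖F z‖ ≤ C₀) (h1 : ∀ z, ‖fderiv ℝ F z‖ ≤ C₁)
    (hdiv : VectorCalculus.IsDivFree F) (α : ℝ) {s : ℝ} (hs : 0 < s) (y : EuclideanSpace ℝ (Fin 3)) :
    VectorCalculus.divergence (fun z => (Real.exp (-(s / 2)) • rotZL (-(α * s)))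
        (heatExtension F (1 - Real.exp (-s)) ((Real.exp (-(s / 2)) • rotZL (α * s)) z))) y = 0 := by
  have hzero : VectorCalculus.divergence F = fun _ => (0:ℝ) := funext hdiv
  rw [divergence_freeSlice hF h0 h1 α hs y, hzero, heatExtension_zero_fun]
  simp

/-- **The free resolvent preserves incompressibility**: `div F = 0 ⇒ div (∫₀^∞ W_s ds) = 0`
(the trace passes under the integral of the space derivatives). -/
theorem isDivFree_freeResolvent (hF : ContDiff ℝ 1 F) (h0 : ∀ z, ‖F z‖ ≤ C₀) (h1 : ∀ z, ‖fderiv ℝ F z‖ ≤ C₁)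
    (hdiv : VectorCalculus.IsDivFree F) (α : ℝ) :
    VectorCalculus.IsDivFree (fun y => ∫ s in Ioi (0:ℝ), (Real.exp (-(s / 2)) • rotZL (-(α * s)))
        (heatExtension F (1 - Real.exp (-s)) ((Real.exp (-(s / 2)) • rotZL (α * s)) y))) := by
  intro y
  rw [divergence_eq_traceCLM, (hasFDerivAt_freeResolvent hF h0 h1 α y).fderiv,
    ← (traceCLM : (EuclideanSpace ℝ (Fin 3) →L[ℝ] EuclideanSpace ℝ (Fin 3)) →L[ℝ] ℝ).integral_comp_comm
      (integrableOn_fderiv_freeSlice hF h0 h1 α y)]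
  refine setIntegral_eq_zero_of_forall_eq_zero fun s hs => ?_
  rw [← divergence_eq_traceCLM]
  exact divergence_freeSlice_eq_zero hF h0 h1 hdiv α hs y

end Div

/-! ## Linearity in the forcing -/

/-- **The free resolvent is linear in the forcing**: for bounded continuous `F, G` and `t ∈ ℝ`,
`W[F + t G] = W[F] + t W[G]` pointwise. -/
theorem freeResolvent_add_smul {F G : EuclideanSpace ℝ (Fin 3) → EuclideanSpace ℝ (Fin 3)} {CF CG : ℝ}
    (hF : Continuous F) (hCF : ∀ z, ‖F z‖ ≤ CF) (hG : Continuous G) (hCG : ∀ z, ‖G z‖ ≤ CG) (t α : ℝ)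
    (y : EuclideanSpace ℝ (Fin 3)) :
    (∫ s in Ioi (0:ℝ), (Real.exp (-(s / 2)) • rotZL (-(α * s)))
        (heatExtension (fun z => F z + t • G z) (1 - Real.exp (-s)) ((Real.exp (-(s / 2)) • rotZL (α * s)) y))) =
      (∫ s in Ioi (0:ℝ), (Real.exp (-(s / 2)) • rotZL (-(α * s)))
        (heatExtension F (1 - Real.exp (-s)) ((Real.exp (-(s / 2)) • rotZL (α * s)) y))) +
      t • ∫ s in Ioi (0:ℝ), (Real.exp (-(s / 2)) • rotZL (-(α * s)))
        (heatExtension G (1 - Real.exp (-s)) ((Real.exp (-(s / 2)) • rotZL (α * s)) y)) := by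
  have htG : Continuous fun z => t • G z := hG.const_smul t
  have hCtG : ∀ z, ‖t • G z‖ ≤ ‖t‖ * CG := fun z => by
    rw [norm_smul]; exact mul_le_mul_of_nonneg_left (hCG z) (norm_nonneg _)
  have hpt : ∀ s ∈ Ioi (0:ℝ), (Real.exp (-(s / 2)) • rotZL (-(α * s)))
        (heatExtension (fun z => F z + t • G z) (1 - Real.exp (-s)) ((Real.exp (-(s / 2)) • rotZL (α * s)) y)) =
      (Real.exp (-(s / 2)) • rotZL (-(α * s)))
        (heatExtension F (1 - Real.exp (-s)) ((Real.exp (-(s / 2)) • rotZL (α * s)) y)) +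
      t • (Real.exp (-(s / 2)) • rotZL (-(α * s)))
        (heatExtension G (1 - Real.exp (-s)) ((Real.exp (-(s / 2)) • rotZL (α * s)) y)) := by
    intro s hs
    have hτ := (heatTime_mem_Ioc hs).1
    rw [heatExtension_add_of_bound hF htG hCF hCtG hτ, heatExtension_const_smul, map_add, map_smul]
  have hGt : Integrable (fun s : ℝ => t • (Real.exp (-(s / 2)) • rotZL (-(α * s)))
      (heatExtension G (1 - Real.exp (-s)) ((Real.exp (-(s / 2)) • rotZL (α * s)) y))) (volume.restrict (Ioi (0:ℝ))) :=
    (integrableOn_freeSlice hG hCG α y).smul t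
  rw [setIntegral_congr_fun measurableSet_Ioi hpt, integral_add (integrableOn_freeSlice hF hCF α y) hGt, integral_smul]

/-! ## The free gate on solenoidal forcings -/

/-- **THE FREE GATE ON THE DIVERGENCE-FREE PART OF THE Y-SCALE.**  There is an absolute constant `C ≥ 0` such that
for every rate `α` and every SOLENOIDAL forcing `F` with `YBound F R`, the free resolvent
`W(y) = ∫₀^∞ (e^{-s/2} R_{−αs}) (e^{(1 − e^{-s})Δ} F)(e^{-s/2} R_{αs} y) ds` is an X-field, `XBound W (C R)`,
is divergence free, and solves `𝓛_(α,0) W + ∇0 = F` — the gate equation of the line with base `U⁰ = 0`, pressure `0`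
and no accretion modes. -/
theorem free_resolvent_divFree :
    ∃ C : ℝ, 0 ≤ C ∧ ∀ (α : ℝ) (F : EuclideanSpace ℝ (Fin 3) → EuclideanSpace ℝ (Fin 3)) (R : ℝ), YBound F R →
      VectorCalculus.IsDivFree F →
      XBound (fun y => ∫ s in Ioi (0:ℝ), (Real.exp (-(s / 2)) • rotZL (-(α * s)))
          (heatExtension F (1 - Real.exp (-s)) ((Real.exp (-(s / 2)) • rotZL (α * s)) y))) (C * R) ∧
      VectorCalculus.IsDivFree (fun y => ∫ s in Ioi (0:ℝ), (Real.exp (-(s / 2)) • rotZL (-(α * s)))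
          (heatExtension F (1 - Real.exp (-s)) ((Real.exp (-(s / 2)) • rotZL (α * s)) y))) ∧
        ∀ y, lerayLin α (fun _ => 0) (fun y => ∫ s in Ioi (0:ℝ), (Real.exp (-(s / 2)) • rotZL (-(α * s)))
          (heatExtension F (1 - Real.exp (-s)) ((Real.exp (-(s / 2)) • rotZL (α * s)) y))) y +
          gradient (fun _ : EuclideanSpace ℝ (Fin 3) => (0:ℝ)) y = F y := by
  obtain ⟨C, hC, h⟩ := free_resolvent
  refine ⟨C, hC, fun α F R hY hdiv => ?_⟩
  obtain ⟨hX, heq⟩ := h α F R hY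
  obtain ⟨hF, h0, h1, -, -⟩ := hY.unpack
  refine ⟨hX, isDivFree_freeResolvent hF h0 h1 hdiv α, fun y => ?_⟩
  rw [heq y]
  have : gradient (fun _ : EuclideanSpace ℝ (Fin 3) => (0:ℝ)) y = 0 := by
    rw [gradient, fderiv_fun_const]; simp
  rw [this, add_zero]

end Summit.NavierStokesRegularity.NavierStokesRegularity.Theorems.KelvinGate

end
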